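import Literature.Analysis.FluidPDE.SingularKernelHolder
import Literature.Analysis.FluidPDE.BiotSavartGradient
import HarnessLib

/-!
# The Biot–Savart kernel is a `C²` singular kernel; Hölder and sup bounds for `∇(K₃ ∗ ω)`

Topic `Literature/Analysis/FluidPDE`. The Biot–Savart kernel `K₃` (`biotSavartCLM`,
`BiotSavartGradient.lean`) satisfies the second-order kernel condition `IsC2SingularKernel` of
`SingularKernelHolder.lean` (its derivative `P₃ = ∇K₃` is smooth off the origin and homogeneous of
degree `−3`, so `∇P₃` is homogeneous of degree `−4` and bounded by a constant times `|z|⁻⁴`,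
Majda–Bertozzi, *Vorticity and Incompressible Flow* (CUP 2002), (4.30)–(4.31)). Consequently
the potential-theory estimates of `SingularKernelHolder.lean` apply to the Biot–Savart law and
give the gradient part of Majda–Bertozzi's **(4.39)** `|K₃ f|_{1,γ} ≤ c ‖f‖_γ` (with Lemma 4.6,
(4.36)): for a compactly supported `γ`-Hölder vorticity, `0 < γ < 1`, the velocity gradient
`∇(K₃ ∗ ω)` is bounded and `γ`-Hölder on all of `ℝ³`, with constants depending only on `γ`
times (`[ω]_γ`, `‖ω‖_∞`, the support radius).

## Contents (all proved)

* `exists_norm_fderiv_fderiv_biotSavartCLM_apply_le` — `‖∇(∇K₃(·) e)(z)‖ ≤ M_e |z|⁻⁴`;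
* `exists_isC2SingularKernel_biotSavartCLM` — `∃ A, IsC2SingularKernel biotSavartCLM A`;
* `exists_norm_fderiv_biotSavart_le` — `‖∇(K₃ ∗ ω)(x)‖ ≤ c(γ) ([ω]_γ R^γ + ‖ω‖_∞)`;
* `exists_norm_fderiv_biotSavart_sub_le` —
  `‖∇(K₃ ∗ ω)(x) − ∇(K₃ ∗ ω)(x̄)‖ ≤ c(γ) ([ω]_γ + ‖ω‖_∞ R^{−γ}) |x − x̄|^γ`.

## References

* A. J. Majda, A. L. Bertozzi, *Vorticity and Incompressible Flow* (CUP 2002), §4.1.3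
  (4.30)–(4.31), Lemma 4.6 (4.35)–(4.36), (4.39); §4.5 Lemma 4.6 (4.89)–(4.90).
  [MajdaBertozziCUP2002]
* D. Gilbarg, N. S. Trudinger, *Elliptic PDE of Second Order* (2001), §4.3 Lemma 4.4.
  [GilbargTrudinger2001]
-/

noncomputable section

open MeasureTheory Set Function Filter Metric Real
open _root_.Topology
open scoped ENNReal NNReal

namespace Literature.Analysis.FluidPDE

/-- Local notation for physical space `ℝ³ = EuclideanSpace ℝ (Fin 3)`. -/
local notation "ℝ³" => EuclideanSpace ℝ (Fin 3)

/-! ### Second derivatives of `K₃` -/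

/-- **Directional second-derivative bound for `K₃`**: for each direction `e` there is `M ≥ 0`
with `‖∇(w ↦ ∇K₃(w) e)(z)‖ ≤ M |z|⁻⁴` for `z ≠ 0` (`w ↦ ∇K₃(w) e` is smooth off the origin and
homogeneous of degree `−3`, so its derivative is homogeneous of degree `−4`, `fderiv_homogeneous`,
and bounded on the unit sphere by compactness; Majda–Bertozzi (4.31)). [cite: MajdaBertozziCUP2002, §4.1.3 (4.30)–(4.31)] -/
theorem exists_norm_fderiv_fderiv_biotSavartCLM_apply_le (e : ℝ³) :
    ∃ M : ℝ, 0 ≤ M ∧ ∀ z : ℝ³, z ≠ 0 →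
      ‖fderiv ℝ (fun w => fderiv ℝ biotSavartCLM w e) z‖ ≤ M * (‖z‖ ^ 4)⁻¹ := by
  set g : ℝ³ → (ℝ³ →L[ℝ] ℝ³) := fun w => fderiv ℝ biotSavartCLM w e with hg
  have hD : ∀ c : ℝ, 0 < c → ∀ z : ℝ³,
      fderiv ℝ biotSavartCLM (c • z) = c ^ ((-2 : ℤ) - 1) • fderiv ℝ biotSavartCLM z :=
    fderiv_homogeneous biotSavartCLM (-2) biotSavartCLM_smul
  have hghom : ∀ c : ℝ, 0 < c → ∀ z : ℝ³, g (c • z) = c ^ (-3 : ℤ) • g z := by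
    intro c hc z
    simp only [hg]
    rw [hD c hc z, smul_apply]
    norm_num
  have hDg : ∀ c : ℝ, 0 < c → ∀ z : ℝ³, fderiv ℝ g (c • z) = c ^ ((-3 : ℤ) - 1) • fderiv ℝ g z :=
    fderiv_homogeneous g (-3) hghom
  have hgC1 : ∀ u : ℝ³, u ≠ 0 → ContDiffAt ℝ 1 g u := by
    intro u hu
    have h1 : ContDiffAt ℝ 1 (fderiv ℝ biotSavartCLM) u :=
      (contDiffAt_biotSavartCLM hu (n := 2)).fderiv_right le_rfl
    exact h1.clm_apply contDiffAt_const
  have hcont : ContinuousOn (fderiv ℝ g) (sphere (0 : ℝ³) 1) := by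
    intro u hu
    have hu0 : u ≠ 0 := by
      intro h
      rw [h, mem_sphere_zero_iff_norm, norm_zero] at hu
      exact zero_ne_one hu
    exact ((hgC1 u hu0).continuousAt_fderiv one_ne_zero).continuousWithinAt
  obtain ⟨M, hM⟩ := (isCompact_sphere (0 : ℝ³) 1).exists_bound_of_continuousOn
    (f := fderiv ℝ g) hcont
  refine ⟨max M 0, le_max_right _ _, fun z hz => ?_⟩
  have hzn : 0 < ‖z‖ := norm_pos_iff.2 hz
  set u : ℝ³ := ‖z‖⁻¹ • z with hu
  have hun : ‖u‖ = 1 := by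
    rw [hu, norm_smul, norm_inv, norm_norm, inv_mul_cancel₀ hzn.ne']
  have hzu : z = ‖z‖ • u := by
    rw [hu, smul_smul, mul_inv_cancel₀ hzn.ne', one_smul]
  have h1 : fderiv ℝ g z = ‖z‖ ^ ((-3 : ℤ) - 1) • fderiv ℝ g u := by
    conv_lhs => rw [hzu]
    exact hDg ‖z‖ hzn u
  have hzpow : ‖z‖ ^ ((-3 : ℤ) - 1) = (‖z‖ ^ 4)⁻¹ := by
    rw [show ((-3 : ℤ) - 1) = -((4 : ℕ) : ℤ) by norm_num, zpow_neg, zpow_natCast]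
  have hMu : ‖fderiv ℝ g u‖ ≤ max M 0 := (hM u (mem_sphere_zero_iff_norm.2 hun)).trans (le_max_left _ _)
  change ‖fderiv ℝ g z‖ ≤ _
  rw [h1, hzpow]
  refine ContinuousLinearMap.opNorm_le_bound _ (by positivity) fun h => ?_
  rw [smul_apply, norm_smul, Real.norm_eq_abs, abs_of_nonneg (by positivity)]
  calc (‖z‖ ^ 4)⁻¹ * ‖fderiv ℝ g u h‖ ≤ (‖z‖ ^ 4)⁻¹ * (‖fderiv ℝ g u‖ * ‖h‖) := by
        gcongr
        exact ContinuousLinearMap.le_opNorm _ _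
    _ ≤ (‖z‖ ^ 4)⁻¹ * (max M 0 * ‖h‖) := by gcongr
    _ = max M 0 * (‖z‖ ^ 4)⁻¹ * ‖h‖ := by ring

/-- **The Biot–Savart kernel is a `C²` singular kernel of degree `−2`**: in addition to
`exists_isC1SingularKernel_biotSavartCLM`, each `w ↦ ∇K₃(w) e` is differentiable off the origin
with `‖∇(∇K₃(·) e)(z)‖ ≤ A ‖e‖ |z|⁻⁴` (expand `e` in the standard basis and add the three
directional bounds). [cite: MajdaBertozziCUP2002, §4.1.3 (4.30)–(4.31)] -/
theorem exists_isC2SingularKernel_biotSavartCLM : ∃ A : ℝ, IsC2SingularKernel biotSavartCLM A := by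
  obtain ⟨A₁, hA₁⟩ := exists_isC1SingularKernel_biotSavartCLM
  have hA₁0 := hA₁.nonneg
  choose M hM0 hM using fun i : Fin 3 =>
    exists_norm_fderiv_fderiv_biotSavartCLM_apply_le (EuclideanSpace.single i (1 : ℝ))
  have hS0 : 0 ≤ ∑ i, M i := Finset.sum_nonneg fun i _ => hM0 i
  set A : ℝ := max A₁ (∑ i, M i) with hA
  have hdiff : ∀ z : ℝ³, z ≠ 0 → ∀ e : ℝ³,
      DifferentiableAt ℝ (fun w => fderiv ℝ biotSavartCLM w e) z := by
    intro z hz e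
    have h1 : ContDiffAt ℝ 1 (fderiv ℝ biotSavartCLM) z :=
      (contDiffAt_biotSavartCLM hz (n := 2)).fderiv_right le_rfl
    exact (h1.clm_apply contDiffAt_const).differentiableAt one_ne_zero
  refine ⟨A, ⟨fun z hz => hA₁.contDiffAt z hz,
    fun z => (hA₁.norm_le z).trans (mul_le_mul_of_nonneg_right (le_max_left _ _) (by positivity)),
    fun z hz => (hA₁.norm_fderiv_le z hz).trans
      (mul_le_mul_of_nonneg_right (le_max_left _ _) (by positivity))⟩, hdiff, fun z hz e => ?_⟩
  -- expand `e` in the standard basis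
  have he : ∀ w : ℝ³, fderiv ℝ biotSavartCLM w e =
      ∑ i, e i • fderiv ℝ biotSavartCLM w (EuclideanSpace.single i (1 : ℝ)) := by
    intro w
    conv_lhs => rw [← (EuclideanSpace.basisFun (Fin 3) ℝ).sum_repr e]
    simp only [map_sum, map_smul, EuclideanSpace.basisFun_repr, EuclideanSpace.basisFun_apply]
  have hsum : HasFDerivAt (fun w => ∑ i, e i • fderiv ℝ biotSavartCLM w (EuclideanSpace.single i (1 : ℝ)))
      (∑ i, e i • fderiv ℝ (fun w => fderiv ℝ biotSavartCLM w (EuclideanSpace.single i (1 : ℝ))) z) z :=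
    HasFDerivAt.fun_sum fun i _ => ((hdiff z hz _).hasFDerivAt).fun_const_smul (e i)
  have hfd : fderiv ℝ (fun w => fderiv ℝ biotSavartCLM w e) z =
      ∑ i, e i • fderiv ℝ (fun w => fderiv ℝ biotSavartCLM w (EuclideanSpace.single i (1 : ℝ))) z := by
    rw [show (fun w => fderiv ℝ biotSavartCLM w e) =
        fun w => ∑ i, e i • fderiv ℝ biotSavartCLM w (EuclideanSpace.single i (1 : ℝ)) from funext he]
    exact hsum.fderiv
  rw [hfd]
  refine ContinuousLinearMap.opNorm_le_bound _ (by positivity) fun h => ?_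
  rw [sum_apply]
  calc ‖∑ i, (e i • fderiv ℝ (fun w => fderiv ℝ biotSavartCLM w (EuclideanSpace.single i (1 : ℝ))) z) h‖
      ≤ ∑ i, ‖(e i • fderiv ℝ (fun w => fderiv ℝ biotSavartCLM w (EuclideanSpace.single i (1 : ℝ))) z) h‖ :=
        norm_sum_le _ _
    _ ≤ ∑ i, (‖e‖ * (‖z‖ ^ 4)⁻¹ * ‖h‖) * M i := by
        refine Finset.sum_le_sum fun i _ => ?_
        rw [smul_apply, norm_smul, Real.norm_eq_abs]
        have hei : |e i| ≤ ‖e‖ := by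
          have := PiLp.norm_apply_le e i
          rwa [Real.norm_eq_abs] at this
        calc |e i| * ‖fderiv ℝ (fun w => fderiv ℝ biotSavartCLM w (EuclideanSpace.single i (1 : ℝ))) z h‖
            ≤ ‖e‖ * (M i * (‖z‖ ^ 4)⁻¹ * ‖h‖) := by
              refine mul_le_mul hei ((ContinuousLinearMap.le_opNorm _ _).trans ?_) (norm_nonneg _)
                (norm_nonneg _)
              gcongr
              exact hM i z hz
          _ = (‖e‖ * (‖z‖ ^ 4)⁻¹ * ‖h‖) * M i := by ring
    _ = (‖e‖ * (‖z‖ ^ 4)⁻¹ * ‖h‖) * ∑ i, M i := by rw [Finset.mul_sum]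
    _ ≤ (‖e‖ * (‖z‖ ^ 4)⁻¹ * ‖h‖) * A := by gcongr; exact le_max_right _ _
    _ = A * ‖e‖ * (‖z‖ ^ 4)⁻¹ * ‖h‖ := by ring

/-! ### Consequences for the Biot–Savart law -/

/-- **Sup bound for the velocity gradient** (Majda–Bertozzi (4.39), sup part): there is
`c = c(γ) ≥ 0` such that for every `γ`-Hölder vorticity `ω` with constant `C`, supported in
`B̄(x₀, R)` and bounded by `M`, `‖∇(K₃ ∗ ω)(x)‖ ≤ c (C R^γ + M)` for all `x`. [cite: MajdaBertozziCUP2002, §4.1.3 Lemma 4.6 (4.35), (4.39)] -/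
theorem exists_norm_fderiv_biotSavart_le {γ : ℝ≥0} (hγ : 0 < γ) :
    ∃ c : ℝ, 0 ≤ c ∧ ∀ (ω : ℝ³ → ℝ³) (C : ℝ≥0) (x₀ : ℝ³) (R M : ℝ), 0 < R → HolderWith C γ ω →
      tsupport ω ⊆ closedBall x₀ R → (∀ y, ‖ω y‖ ≤ M) →
        ∀ x, ‖fderiv ℝ (biotSavart ω) x‖ ≤ c * (C * R ^ (γ : ℝ) + M) := by
  obtain ⟨A, hA⟩ := exists_isC1SingularKernel_biotSavartCLM
  obtain ⟨B, hB0, hB⟩ := exists_norm_fderiv_radialCutoff_le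
  have hA0 := hA.nonneg
  have hγ' : (0 : ℝ) < γ := by exact_mod_cast hγ
  refine ⟨max (A * (4 * π * (8 : ℝ) ^ (γ : ℝ) / γ)) (256 * π / 3 * A + 128 * π / 3 * A * B),
    le_max_of_le_right (by positivity), fun ω C x₀ R M hR hω hsupp hM x => ?_⟩
  have hM0 : 0 ≤ M := (norm_nonneg _).trans (hM x)
  have h := norm_fderiv_singularPotential_le hA hB0 hB hγ hω hR hsupp hM x
  rw [singularPotential_biotSavartCLM] at h
  refine h.trans ?_
  rw [Real.mul_rpow (by norm_num) hR.le]
  set c := max (A * (4 * π * (8 : ℝ) ^ (γ : ℝ) / γ)) (256 * π / 3 * A + 128 * π / 3 * A * B)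
  have h1 : A * (4 * π * (8 : ℝ) ^ (γ : ℝ) / γ) ≤ c := le_max_left _ _
  have h2 : 256 * π / 3 * A + 128 * π / 3 * A * B ≤ c := le_max_right _ _
  have hRγ : 0 ≤ (R : ℝ) ^ (γ : ℝ) := by positivity
  calc A * C * (4 * π * ((8 : ℝ) ^ (γ : ℝ) * R ^ (γ : ℝ)) / γ) + 256 * π / 3 * A * M + 128 * π / 3 * A * B * M
      = (A * (4 * π * (8 : ℝ) ^ (γ : ℝ) / γ)) * (C * R ^ (γ : ℝ)) +
          (256 * π / 3 * A + 128 * π / 3 * A * B) * M := by ring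
    _ ≤ c * (C * R ^ (γ : ℝ)) + c * M := by gcongr
    _ = c * (C * R ^ (γ : ℝ) + M) := by ring

/-- **Hölder bound for the velocity gradient** (Majda–Bertozzi (4.39) with Lemma 4.6 (4.36),
Hölder part; Gilbarg–Trudinger Lemma 4.4): for `0 < γ < 1` there is `c = c(γ) ≥ 0` such that for
every `γ`-Hölder vorticity `ω` with constant `C`, supported in `B̄(x₀, R)` and bounded by `M`,
`‖∇(K₃ ∗ ω)(x) − ∇(K₃ ∗ ω)(x̄)‖ ≤ c (C + M R^{−γ}) |x − x̄|^γ` for all `x, x̄`. [cite: MajdaBertozziCUP2002, §4.1.3 Lemma 4.6 (4.36), (4.39)] -/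
theorem exists_norm_fderiv_biotSavart_sub_le {γ : ℝ≥0} (hγ : 0 < γ) (hγ1 : (γ : ℝ) < 1) :
    ∃ c : ℝ, 0 ≤ c ∧ ∀ (ω : ℝ³ → ℝ³) (C : ℝ≥0) (x₀ : ℝ³) (R M : ℝ), 0 < R → HolderWith C γ ω →
      tsupport ω ⊆ closedBall x₀ R → (∀ y, ‖ω y‖ ≤ M) →
        ∀ x x', ‖fderiv ℝ (biotSavart ω) x - fderiv ℝ (biotSavart ω) x'‖ ≤
          c * (C + M * (R ^ (γ : ℝ))⁻¹) * ‖x - x'‖ ^ (γ : ℝ) := by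
  obtain ⟨A, hA⟩ := exists_isC2SingularKernel_biotSavartCLM
  obtain ⟨B, hB0, hB⟩ := exists_norm_fderiv_radialCutoff_le
  have hA0 := hA.toIsC1SingularKernel.nonneg
  have hγ' : (0 : ℝ) < γ := by exact_mod_cast hγ
  have hc₁ := holderGradConstC_nonneg hA0 hB0 hγ' hγ1
  have hc₂ := holderGradConstM_nonneg (A := A) hA0 hB0
  refine ⟨max (holderGradConstC A B γ) (holderGradConstM A B), le_max_of_le_left hc₁,
    fun ω C x₀ R M hR hω hsupp hM x x' => ?_⟩
  have hM0 : 0 ≤ M := (norm_nonneg _).trans (hM x)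
  have h := norm_fderiv_singularPotential_sub_le hA hB0 hB hγ hγ1 hω hR hsupp hM x x'
  rw [singularPotential_biotSavartCLM] at h
  refine h.trans ?_
  have hRγ : 0 ≤ (R ^ (γ : ℝ))⁻¹ := by positivity
  gcongr
  calc holderGradConstC A B γ * C + holderGradConstM A B * M * (R ^ (γ : ℝ))⁻¹
      ≤ max (holderGradConstC A B γ) (holderGradConstM A B) * C +
          max (holderGradConstC A B γ) (holderGradConstM A B) * M * (R ^ (γ : ℝ))⁻¹ := by
        gcongr
        · exact le_max_left _ _
        · exact le_max_right _ _
    _ = _ := by ring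

end Literature.Analysis.FluidPDE
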